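import Mathlib
import Summits.CriticalPhenomena.Ising3DConformalLimit.Theses.SynchronousCoupling
import Literature.Probability.LatticeModels.IsingThermodynamics
import Literature.Barriers.CriticalPhenomena.PositionSpaceRGNonGibbsian

/-!
# Sketch (crux-ideate, ideator 2) for crux `RotationJoining` (stmt-CriticalPhenomena-18763)

First-lemma signatures for the two idea cards
* `twin-superposition-symmetric-path`  (card A): `JoinabilityTransfer`, `GammaSamplingBound`,
  `BlockVarianceLower`;
* (card A, supporting structure, formerly card B): `LayerDecimationGibbsian`,
  `RotationIsLayerReversal`;
* `rate-from-dilations-splitting` (card C): `RateBootstrap`, `SplittingTransfer` over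
  `DilationJoiningsAxis3`, `DilationJoiningsTilted`, `QualitativeRotationJoining`, `AsymptoticFDDIsotropy`.
Nothing here is proved; every declaration is a `Prop` (or data) and elaborates.

Geometry (checked by hand, see NOTES.md): `T = A/3`, `A = ((2,2,-1),(-1,2,2),(2,-1,2))`, is the
rotation by 60° about `[111]`; `T² ∈ B₃`; the coincidence lattice `Γ = ℤ³ ∩ Tℤ³ = {x | 3 ∣ x₀+x₁+x₂}`
has index 3, `TΓ = Γ`, and in the basis `b₁=(1,-1,0), b₂=(0,1,-1), b₃=(1,1,1)` of `Γ` the maps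
`T|_Γ`, the `(111)`-mirror `R|_Γ` and `(-P)|_Γ` (`P` the cyclic permutation) are the integer matrices
`MT`, `MR`, `MNP` below, with `MT = MR * MNP`.
-/

namespace Summit.CriticalPhenomena.Ising3DConformalLimit.Cruxes.RotationJoining.SketchIdeator2

open MeasureTheory Literature.Probability.LatticeModels

noncomputable section

/-! ## Geometry of the Σ3 coincidence lattice -/

/-- `A = 3T`. -/
def A3 : Matrix (Fin 3) (Fin 3) ℤ := !![2, 2, -1; -1, 2, 2; 2, -1, 2]

/-- `x₀ + x₁ + x₂`. -/
def coordSum (x : Site 3) : ℤ := x 0 + x 1 + x 2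

/-- membership in the coincidence lattice `Γ = ℤ³ ∩ Tℤ³`. -/
def InGamma (x : Site 3) : Prop := (3 : ℤ) ∣ coordSum x

instance : DecidablePred InGamma := fun x => inferInstanceAs (Decidable ((3 : ℤ) ∣ coordSum x))

/-- `T` on `Γ` (exact division by 3), identity off `Γ`: a bijection of `Site 3` acting as the
60° rotation on `Γ`. -/
def tmap (x : Site 3) : Site 3 :=
  if InGamma x then (fun i => (A3.mulVec x i) / 3) else x

/-- `T⁻¹ = Tᵀ = Aᵀ/3` on `Γ`, identity off `Γ` (inverse of `tmap`). -/
def tmapInv (x : Site 3) : Site 3 :=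
  if InGamma x then (fun i => (A3.transpose.mulVec x i) / 3) else x

/-- The axis cell `n(u + [0,1)³) ∩ ℤ³` (copy 2 of the crux). -/
def axisCell (n : ℕ) (u : Fin 3 → ℤ) : Finset (Site 3) :=
  Fintype.piFinset fun i => Finset.Ico ((n : ℤ) * u i) ((n : ℤ) * u i + (n : ℤ))

/-- The tilted cell `{x | A x ∈ 3n(u+[0,1)³)}` inside the bookkeeping box (copy 1 of the crux). -/
def tiltCell (n m : ℕ) (u : Fin 3 → ℤ) : Finset (Site 3) :=
  (Fintype.piFinset fun _ : Fin 3 =>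
      Finset.Icc (-(2 * (n : ℤ) * ((m : ℤ) + 1))) (2 * (n : ℤ) * ((m : ℤ) + 1))).filter
    fun x => ∀ i, 3 * (n : ℤ) * u i ≤ A3.mulVec x i ∧ A3.mulVec x i < 3 * (n : ℤ) * (u i + 1)

/-- spin sum over a finite cell. -/
def blockSum (S : Finset (Site 3)) (σ : SpinConfig (Site 3)) : ℝ := ∑ x ∈ S, spinAt x σ

/-- the crux's normaliser of copy 2 (axis cell at `u = 0`). -/
def normAxis (μ : Measure (SpinConfig (Site 3))) (n : ℕ) : ℝ :=
  (Real.sqrt (∫ σ, (blockSum (axisCell n 0) σ) ^ 2 ∂μ))⁻¹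

/-- the crux's normaliser of copy 1 (tilted cell at `u = 0`). -/
def normTilt (μ : Measure (SpinConfig (Site 3))) (n m : ℕ) : ℝ :=
  (Real.sqrt (∫ σ, (blockSum (tiltCell n m 0) σ) ^ 2 ∂μ))⁻¹

/-! ## Card A — first lemma: joinability with a `T`-invariant partner transfers to `RotationJoining`

`StrainedPartnerJoining`: the critical measure admits, at every scale and window, a coupling with SOME
`tmap`-invariant law `ν` (the proposed witness is the `Γ`-field of the symmetric twin-superposition
bicrystal `ℤ³ ∪ Tℤ³` read through cells strained along `[111]`; the lemma is blind to the witness)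
under which the axis blocks of `σ` match a partner functional `W u η` AND the tilted blocks of `σ`
match the SAME functional of the rotated partner `η ∘ tmapInv` (so that a witness `W u η :=` block of
`η` over a cell `c_u` gives `W u (η ∘ tmapInv) =` block over `T⁻¹ c_u`, the tilt of the crux).  Gluing two copies of this coupling
along the partner (disintegration on the standard Borel space `SpinConfig (Site 3)`) gives the
self-joining of the crux with constant `4C`. -/

/-- hypothesis of the transfer lemma. -/
def StrainedPartnerJoining : Prop :=
  ∀ μ ∈ isingGibbsMeasures 3 (criticalBeta 3) 0, IsTranslationInvariantMeasure μ →
    ∃ (ν : Measure (SpinConfig (Site 3))), IsProbabilityMeasure ν ∧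
      ν.map (fun η : SpinConfig (Site 3) => η ∘ tmap) = ν ∧
      ∃ C θ : ℝ, 0 < θ ∧ ∀ n m : ℕ, 1 ≤ n →
        ∃ W : (Fin 3 → ℤ) → SpinConfig (Site 3) → ℝ, (∀ u, Measurable (W u)) ∧
        ∃ π : Measure (SpinConfig (Site 3) × SpinConfig (Site 3)), π.fst = μ ∧ π.snd = ν ∧
          ∀ u : Fin 3 → ℤ, (∀ i, |u i| ≤ m) →
            ∫ q, (normAxis μ n * blockSum (axisCell n u) q.1 - W u q.2) ^ 2 ∂π ≤ C * (n : ℝ) ^ (-θ) ∧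
            ∫ q, (normTilt μ n m * blockSum (tiltCell n m u) q.1 - W u (q.2 ∘ tmapInv)) ^ 2 ∂π
              ≤ C * (n : ℝ) ^ (-θ)

/-- **Card A, first lemma (transfer).** -/
def JoinabilityTransfer : Prop :=
  StrainedPartnerJoining →
    Summit.CriticalPhenomena.Ising3DConformalLimit.Theses.SynchronousCoupling.RotationJoining

/-! ## Shared lemma: sampling the block spin on `Γ` (IR bound with a mean-zero 3-periodic weight) -/

/-- the mean-zero weight `1_Γ - 1/3`. -/
def gammaWeight (x : Site 3) : ℝ := (if InGamma x then 1 else 0) - 1 / 3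

/-- `∑_{x,y ∈ cell} (1_Γ-1/3)(x)(1_Γ-1/3)(y) ⟨σ_xσ_y⟩_{β_c} ≤ C n³` (Gaussian domination off the zero
mode: the weight lives at momenta `±(2π/3)(1,1,1)` where `1/(2β E(k))` is bounded). -/
def GammaSamplingBound : Prop :=
  ∃ C : ℝ, ∀ n : ℕ, 1 ≤ n →
    ∑ x ∈ axisCell n 0, ∑ y ∈ axisCell n 0,
        gammaWeight x * gammaWeight y * criticalTwoPoint 3 (x - y) ≤ C * (n : ℝ) ^ 3

/-- `c n⁴ ≤ ∑_{x,y ∈ cell} ⟨σ_xσ_y⟩_{β_c}` from `criticalTwoPoint_bounds` (`⟨σ₀σ_x⟩ ≥ c‖x‖⁻²`). -/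
def BlockVarianceLower : Prop :=
  ∃ c : ℝ, 0 < c ∧ ∀ n : ℕ, 1 ≤ n →
    c * (n : ℝ) ^ 4 ≤ ∑ x ∈ axisCell n 0, ∑ y ∈ axisCell n 0, criticalTwoPoint 3 (x - y)

/-! ## Card B — first lemmas: the third-(111)-layer decimation is Gibbsian, and `T` is its time reversal -/

/-- columns `b₁ = (1,-1,0)`, `b₂ = (0,1,-1)`, `b₃ = (1,1,1)`: a basis of `Γ`. -/
def gammaBasis : Matrix (Fin 3) (Fin 3) ℤ := !![1, 0, 1; -1, 1, 1; 0, -1, 1]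

/-- decimation onto `Γ`, re-indexed by `ℤ³` through `gammaBasis` (`y ↦ σ (B y)`); the third coordinate
is the `(111)`-layer index. -/
def layerDecimate (σ : SpinConfig (Site 3)) : SpinConfig (Site 3) := fun y => σ (gammaBasis.mulVec y)

/-- **Card B, first lemma (Dobrushin regime of the hidden honeycomb bilayers).** For `3·tanh β < 1` the
`Γ`-decimation of every Ising Gibbs measure on `ℤ³` at `(β, 0)` is quasilocal (indeed Gibbs for an
absolutely summable potential of layer-range one).  At `β = β_c(3) = 0.2217`, `3 tanh β = 0.654`. -/
def LayerDecimationGibbsian : Prop :=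
  ∀ β : ℝ, 0 ≤ β → 3 * Real.tanh β < 1 →
    ∀ μ ∈ isingGibbsMeasures 3 β 0,
      Literature.Barriers.CriticalPhenomena.NonGibbs.IsQuasilocalMeasure (μ.map layerDecimate)

/-- `T|_Γ` in the basis `gammaBasis` (order 6). -/
def MT : Matrix (Fin 3) (Fin 3) ℤ := !![0, 1, 0; -1, 1, 0; 0, 0, 1]
/-- the `(111)` mirror `R|_Γ`: reversal of the layer index. -/
def MR : Matrix (Fin 3) (Fin 3) ℤ := !![1, 0, 0; 0, 1, 0; 0, 0, -1]
/-- `(-P)|_Γ`, `P (x₀,x₁,x₂) = (x₂,x₀,x₁)`; `-P ∈ B₃`. -/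
def MNP : Matrix (Fin 3) (Fin 3) ℤ := !![0, 1, 0; -1, 1, 0; 0, 0, -1]

/-- `-P` on `ℤ³`. -/
def negCyc (x : Site 3) : Site 3 := ![-(x 2), -(x 0), -(x 1)]

example : MT = MR * MNP := by decide

/-- **Card B, first lemma (exact identity).** For a `B₃`-invariant law (the critical measure is unique,
`hasUniqueGibbsMeasure_criticalBeta_holds`, hence `B₃`-invariant) the rotated decimated field
`ξ ∘ T` has the law of the layer-REVERSED decimated field `ξ ∘ R`: RotationJoining's rotation is the
time reversal of the `[111]` layer chain. -/
def RotationIsLayerReversal : Prop :=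
  ∀ μ : Measure (SpinConfig (Site 3)),
    μ.map (fun σ : SpinConfig (Site 3) => σ ∘ negCyc) = μ →
      (μ.map layerDecimate).map (fun ξ : SpinConfig (Site 3) => fun y => ξ (MT.mulVec y)) =
        (μ.map layerDecimate).map (fun ξ : SpinConfig (Site 3) => fun y => ξ (MR.mulVec y))


/-! ## Card C — first lemmas: the rate is inherited from dilation joinings (d̄₂ splitting)

`RateBootstrap`: dilation joinings for axis cells (the route's `DilationJoinings`, `p = 3` suffices) and
for tilted cells, plus a QUALITATIVE window-uniform rotation joining (defect `→ 0`, no rate), give the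
crux with rate `θ` (chain of glued couplings along the scales `n, 3n, …, 3ʲn`, Minkowski in `L²` of the
glued space, geometric series).  `SplittingTransfer`: the qualitative joining itself follows from the two
dilation joinings and the rate-free, coupling-free `AsymptoticFDDIsotropy` (Ornstein's `d̄₂` is complete on
stationary laws; equal finite-dimensional limits ⇒ equal `d̄₂`-limits ⇒ `d̄₂ → 0`). -/

/-- dilation joinings for the TILTED cells `T⁻¹(bQ_u)` with `p = 3` (same shape as the route's r2). -/
def DilationJoiningsTilted : Prop :=
  ∀ μ ∈ isingGibbsMeasures 3 (criticalBeta 3) 0, IsTranslationInvariantMeasure μ →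
    ∃ C θ : ℝ, 0 < θ ∧ ∀ b m : ℕ, 1 ≤ b →
      ∃ π : Measure (SpinConfig (Site 3) × SpinConfig (Site 3)), π.fst = μ ∧ π.snd = μ ∧
        ∀ u : Fin 3 → ℤ, (∀ i, |u i| ≤ m) →
          ∫ q, (normTilt μ (3 * b) m * blockSum (tiltCell (3 * b) m u) q.1
                  - normTilt μ b m * blockSum (tiltCell b m u) q.2) ^ 2 ∂π ≤ C * (b : ℝ) ^ (-θ)

/-- dilation joinings for axis cells with `p = 3` (the `p = 3` half of the route's `DilationJoinings`). -/
def DilationJoiningsAxis3 : Prop :=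
  ∀ μ ∈ isingGibbsMeasures 3 (criticalBeta 3) 0, IsTranslationInvariantMeasure μ →
    ∃ C θ : ℝ, 0 < θ ∧ ∀ b m : ℕ, 1 ≤ b →
      ∃ π : Measure (SpinConfig (Site 3) × SpinConfig (Site 3)), π.fst = μ ∧ π.snd = μ ∧
        ∀ u : Fin 3 → ℤ, (∀ i, |u i| ≤ m) →
          ∫ q, (normAxis μ (3 * b) * blockSum (axisCell (3 * b) u) q.1
                  - normAxis μ b * blockSum (axisCell b u) q.2) ^ 2 ∂π ≤ C * (b : ℝ) ^ (-θ)

/-- qualitative, WINDOW-UNIFORM rotation joining: defect `≤ ε` for all large scales, no rate. -/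
def QualitativeRotationJoining : Prop :=
  ∀ μ ∈ isingGibbsMeasures 3 (criticalBeta 3) 0, IsTranslationInvariantMeasure μ →
    ∀ ε : ℝ, 0 < ε → ∃ N : ℕ, ∀ n m : ℕ, N ≤ n →
      ∃ π : Measure (SpinConfig (Site 3) × SpinConfig (Site 3)), π.fst = μ ∧ π.snd = μ ∧
        ∀ u : Fin 3 → ℤ, (∀ i, |u i| ≤ m) →
          ∫ q, (normTilt μ n m * blockSum (tiltCell n m u) q.1
                  - normAxis μ n * blockSum (axisCell n u) q.2) ^ 2 ∂π ≤ ε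

/-- **Card C, first lemma (rate bootstrap, provable now by gluing).** -/
def RateBootstrap : Prop :=
  DilationJoiningsAxis3 → DilationJoiningsTilted → QualitativeRotationJoining →
    Summit.CriticalPhenomena.Ising3DConformalLimit.Theses.SynchronousCoupling.RotationJoining

/-- rate-free, coupling-free, finite-window isotropy of the limiting block process: for every finite
family of block indices and every bounded `1`-Lipschitz test function, the expectations over tilted and
over axis cells have the same limit (both limits exist by the dilation joinings). -/
def AsymptoticFDDIsotropy : Prop :=
  ∀ μ ∈ isingGibbsMeasures 3 (criticalBeta 3) 0, IsTranslationInvariantMeasure μ →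
    ∀ (j m : ℕ) (us : Fin j → (Fin 3 → ℤ)), (∀ i l, |us i l| ≤ m) →
      ∀ f : (Fin j → ℝ) → ℝ, LipschitzWith 1 f → (∃ B : ℝ, ∀ v, |f v| ≤ B) →
        Filter.Tendsto
          (fun n : ℕ =>
            (∫ σ, f (fun i => normTilt μ n m * blockSum (tiltCell n m (us i)) σ) ∂μ) -
              ∫ σ, f (fun i => normAxis μ n * blockSum (axisCell n (us i)) σ) ∂μ)
          Filter.atTop (nhds 0)

/-- **Card C, transfer.** -/
def SplittingTransfer : Prop :=
  DilationJoiningsAxis3 → DilationJoiningsTilted → AsymptoticFDDIsotropy →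
    Summit.CriticalPhenomena.Ising3DConformalLimit.Theses.SynchronousCoupling.RotationJoining

end

end Summit.CriticalPhenomena.Ising3DConformalLimit.Cruxes.RotationJoining.SketchIdeator2
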